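import Summits.Schanuel.Schanuel.Theorems.RootDecomp1AtomRigidity

/-!
# Rigidity of the tight atom under one-defect Schanuel (route-Schanuel-RootDecomp1, lens-1 round 8 «RigidityLayer» — tree port) — part 2 (§5–§6: basis change, kernel transfer)

Kernel theorems about the items of `route-Schanuel-RootDecomp1` (no item is restated; every hypothesis is a
live item BY NAME or plain data):

* `span_le_of_atom_of_failure` — under `DefectOneSchanuel` (B, 25020) the ℚ-span of a TIGHT ATOM (ℚ-l.i.,
  `trdeg ℚ(z,e^z) < n`, span-minimal in the span-local sense of items 29645 / 30352 / 30353) lies inside the span of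
  every failing ℚ-l.i. tuple; `atom_span_unique`; `conj_mem_span_of_atom` (the atom is conjugation-stable);
  `exists_atom_of_failure` (no hypothesis); `real_or_unitary_of_defectOne : B → 1C.RealSchanuel ∨ 1C.UnitarySchanuel`.
* span invariance of `trdeg ℚ(z,e^z)`, `ℚ(z)`, `trdeg ℚ(e^z)` under a ℚ-change of basis (`*_of_basis_change`).
* `entangled_of_axisRestricted` — `B → L → Q → U⊥ → (30352 restricted to AXIS tuples) → 30352`
  (`EntangledSaturatedEssentialSchanuel`), the restricted statement spelled out as a hypothesis (it is the lens's
  proposed round-8 residual `AxisEntangledSaturatedEssentialSchanuel`, not an item yet); `entangled_of_conjStableRestricted`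
  likewise for the conjugation-stable restriction.

Computation credit: the submodular count is lens-2 gen-0 `DefectLattice.closes_lattice` / lens-5 gen-2
`firstFailureConjStable_of_defectOne` (HOME files, global-minimality forms); the span-local form, the transfer and the
cross-route disjunction are lens-1 gen 8.  `--supports stmt-Schanuel-30352`.
-/

set_option linter.dupNamespace false

noncomputable section

namespace Summit.Schanuel.Schanuel.Theorems.RootDecomp1AtomRigidity

open Complex IntermediateField
open scoped BigOperators Cardinal ComplexConjugate
open Summit.Schanuel.Schanuel.Theses.RootDecomp1 (SchanuelTwo EssentialCounterexamplesInEcl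
  DefectOneSchanuel LinearSchanuel QuadraticSchanuel RationalImageSchanuel
  NonrationalSaturatedEssentialSchanuel EntangledSaturatedEssentialSchanuel
  DisjointSaturatedEssentialSchanuel NonrationalSaturatedEssentialSchanuelGlue)
open Summit.Schanuel.Schanuel.Theorems.RootDecomp1DefectSplit (trdeg_adjoin_le_of_isAlgebraic isAlgebraic_of_mem_gens)
open Summit.Schanuel.Schanuel.Theorems.RootDecomp1EAnchor (isAlgebraic_of_le trdeg_adjoin_sum_le_union
  trdeg_adjoin_union_le_sum)
open Summit.Schanuel.Schanuel.Theorems.RootDecomp1EntanglementSplit (nonrationalSaturatedEssentialSchanuelGlue_holds)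
open Summit.Schanuel.Schanuel.Theorems.RootDecomp1EssentialInEcl (essentialCounterexamplesInEcl_holds)
open Summit.Schanuel.Schanuel.Theorems.RootDecomp1CAxisReduction (exists_axis_tuple_of_conj_stable)
open Literature.NumberTheory.Transcendental (exists_nsmul_mem_span_int mem_adjoin_of_mem_span_int
  trdeg_adjoin_le_of_le Kirby2010_ecl_isExpSubfield_holds)

/-! ## §5  Span invariance under a ℚ-change of basis (the entanglement grade is a span invariant) -/

section BasisChange

variable {ι κ : Type*} {z : ι → ℂ} {w : κ → ℂ}

/-- If every `w i` lies in the `ℤ`-span of `z` then `ℚ(w, e^w) ≤ ℚ(z, e^z)`. -/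
theorem adjoin_pair_le_of_mem_span_int (hw : ∀ i, w i ∈ Submodule.span ℤ (Set.range z)) :
    adjoin ℚ (Set.range w ∪ Set.range (Complex.exp ∘ w)) ≤
      adjoin ℚ (Set.range z ∪ Set.range (Complex.exp ∘ z)) := by
  rw [adjoin_le_iff]
  rintro a (⟨i, rfl⟩ | ⟨i, rfl⟩)
  · exact (mem_adjoin_of_mem_span_int z (hw i)).1
  · exact (mem_adjoin_of_mem_span_int z (hw i)).2

/-- … `ℚ(w) ≤ ℚ(z)` … -/
theorem adjoin_range_le_of_mem_span_int (hw : ∀ i, w i ∈ Submodule.span ℤ (Set.range z)) :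
    adjoin ℚ (Set.range w) ≤ adjoin ℚ (Set.range z) := by
  rw [adjoin_le_iff]
  rintro a ⟨i, rfl⟩
  exact mem_adjoin_range_of_mem_span_int z (hw i)

/-- … and `ℚ(e^w) ≤ ℚ(e^z)`. -/
theorem adjoin_exp_le_of_mem_span_int (hw : ∀ i, w i ∈ Submodule.span ℤ (Set.range z)) :
    adjoin ℚ (Set.range (Complex.exp ∘ w)) ≤ adjoin ℚ (Set.range (Complex.exp ∘ z)) := by
  rw [adjoin_le_iff]
  rintro a ⟨i, rfl⟩
  exact exp_mem_adjoin_exp_of_mem_span_int z (hw i)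

/-- If `z l` lies in the `ℚ`-span of `w` then `z l ∈ ℚ(w)` (clear denominators, divide back). -/
theorem mem_adjoin_range_of_mem_span (hz : ∀ l, z l ∈ Submodule.span ℚ (Set.range w)) (l : ι) :
    z l ∈ adjoin ℚ (Set.range w) := by
  obtain ⟨M, hM, hmem⟩ := exists_nsmul_mem_span_int w (hz l)
  have h := mem_adjoin_range_of_mem_span_int w hmem
  rw [Rat.smul_def, Rat.cast_natCast] at h
  exact mem_of_natCast_mul_mem hM h

/-- … `z l ∈ ℚ(w, e^w)` … -/
theorem mem_adjoin_pair_of_mem_span (hz : ∀ l, z l ∈ Submodule.span ℚ (Set.range w)) (l : ι) :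
    z l ∈ adjoin ℚ (Set.range w ∪ Set.range (Complex.exp ∘ w)) := by
  obtain ⟨M, hM, hmem⟩ := exists_nsmul_mem_span_int w (hz l)
  have h := (mem_adjoin_of_mem_span_int w hmem).1
  rw [Rat.smul_def, Rat.cast_natCast] at h
  exact mem_of_natCast_mul_mem hM h

/-- … `e^{z l}` is algebraic over `ℚ(e^w)` (a power of it lies there) … -/
theorem isAlgebraic_exp_of_mem_span (hz : ∀ l, z l ∈ Submodule.span ℚ (Set.range w)) (l : ι) :
    IsAlgebraic ↥(adjoin ℚ (Set.range (Complex.exp ∘ w))) (Complex.exp (z l)) := by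
  obtain ⟨M, hM, hmem⟩ := exists_nsmul_mem_span_int w (hz l)
  have h := exp_mem_adjoin_exp_of_mem_span_int w hmem
  rw [Rat.smul_def, Rat.cast_natCast, Complex.exp_nat_mul] at h
  exact IsAlgebraic.of_pow (Nat.pos_of_ne_zero hM)
    (isAlgebraic_algebraMap (⟨Complex.exp (z l) ^ M, h⟩ : ↥(adjoin ℚ (Set.range (Complex.exp ∘ w)))))

/-- … and `e^{z l}` is algebraic over `ℚ(w, e^w)`. -/
theorem isAlgebraic_exp_of_mem_span' (hz : ∀ l, z l ∈ Submodule.span ℚ (Set.range w)) (l : ι) :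
    IsAlgebraic ↥(adjoin ℚ (Set.range w ∪ Set.range (Complex.exp ∘ w))) (Complex.exp (z l)) := by
  obtain ⟨M, hM, hmem⟩ := exists_nsmul_mem_span_int w (hz l)
  have h := (mem_adjoin_of_mem_span_int w hmem).2
  rw [Rat.smul_def, Rat.cast_natCast, Complex.exp_nat_mul] at h
  exact IsAlgebraic.of_pow (Nat.pos_of_ne_zero hM)
    (isAlgebraic_algebraMap
      (⟨Complex.exp (z l) ^ M, h⟩ : ↥(adjoin ℚ (Set.range w ∪ Set.range (Complex.exp ∘ w)))))

/-- **Span invariance I.**  `trdeg ℚ(w, e^w) = trdeg ℚ(z, e^z)` whenever `w ⊆ span_ℤ z` and `z ⊆ span_ℚ w`. -/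
theorem trdeg_pair_eq_of_basis_change (hw : ∀ i, w i ∈ Submodule.span ℤ (Set.range z))
    (hz : ∀ l, z l ∈ Submodule.span ℚ (Set.range w)) :
    Algebra.trdeg ℚ ↥(adjoin ℚ (Set.range w ∪ Set.range (Complex.exp ∘ w))) =
      Algebra.trdeg ℚ ↥(adjoin ℚ (Set.range z ∪ Set.range (Complex.exp ∘ z))) := by
  refine le_antisymm (trdeg_le_of_injective (inclusion (adjoin_pair_le_of_mem_span_int hw))
    (inclusion_injective _)) ?_
  apply trdeg_adjoin_le_of_isAlgebraic (adjoin ℚ (Set.range w ∪ Set.range (Complex.exp ∘ w)))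
  rintro x (⟨l, rfl⟩ | ⟨l, rfl⟩)
  · exact isAlgebraic_algebraMap
      (⟨z l, mem_adjoin_pair_of_mem_span hz l⟩ : ↥(adjoin ℚ (Set.range w ∪ Set.range (Complex.exp ∘ w))))
  · exact isAlgebraic_exp_of_mem_span' hz l

/-- **Span invariance II.**  `ℚ(w) = ℚ(z)` under the same hypotheses. -/
theorem adjoin_range_eq_of_basis_change (hw : ∀ i, w i ∈ Submodule.span ℤ (Set.range z))
    (hz : ∀ l, z l ∈ Submodule.span ℚ (Set.range w)) :
    adjoin ℚ (Set.range w) = adjoin ℚ (Set.range z) := by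
  refine le_antisymm (adjoin_range_le_of_mem_span_int hw) ?_
  rw [adjoin_le_iff]
  rintro a ⟨l, rfl⟩
  exact mem_adjoin_range_of_mem_span hz l

/-- **Span invariance III.**  `trdeg ℚ(e^w) = trdeg ℚ(e^z)` under the same hypotheses. -/
theorem trdeg_exp_eq_of_basis_change (hw : ∀ i, w i ∈ Submodule.span ℤ (Set.range z))
    (hz : ∀ l, z l ∈ Submodule.span ℚ (Set.range w)) :
    Algebra.trdeg ℚ ↥(adjoin ℚ (Set.range (Complex.exp ∘ w))) =
      Algebra.trdeg ℚ ↥(adjoin ℚ (Set.range (Complex.exp ∘ z))) := by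
  refine le_antisymm (trdeg_le_of_injective (inclusion (adjoin_exp_le_of_mem_span_int hw))
    (inclusion_injective _)) ?_
  apply trdeg_adjoin_le_of_isAlgebraic (adjoin ℚ (Set.range (Complex.exp ∘ w)))
  rintro x ⟨l, rfl⟩
  exact isAlgebraic_exp_of_mem_span hz l

end BasisChange

/-- `ecl ∅` is a ℚ-subspace of ℂ: the ℚ-span of a tuple from `ecl ∅` stays in `ecl ∅`
[cite: Kirby2010, Lemma 3.3 (`Kirby2010_ecl_isExpSubfield`)]. -/
theorem mem_ecl_of_mem_span {n : ℕ} {z : Fin n → ℂ}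
    (hecl : ∀ i, z i ∈ Literature.NumberTheory.Transcendental.ecl (∅ : Set ℂ)) {a : ℂ}
    (ha : a ∈ Submodule.span ℚ (Set.range z)) :
    a ∈ Literature.NumberTheory.Transcendental.ecl (∅ : Set ℂ) := by
  obtain ⟨⟨SE, hSE⟩, -⟩ := Kirby2010_ecl_isExpSubfield_holds ℂ ∅
  let EQ : Submodule ℚ ℂ :=
    { carrier := Literature.NumberTheory.Transcendental.ecl (∅ : Set ℂ)
      add_mem' := fun {a b} ha hb => by
        rw [← hSE] at ha hb ⊢; exact SE.add_mem ha hb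
      zero_mem' := by rw [← hSE]; exact SE.zero_mem
      smul_mem' := fun q {a} ha => by
        rw [← hSE] at ha ⊢
        rw [Rat.smul_def]
        exact SE.mul_mem (SubfieldClass.ratCast_mem SE q) ha }
  have hle : Submodule.span ℚ (Set.range z) ≤ EQ :=
    Submodule.span_le.mpr (Set.range_subset_iff.mpr hecl)
  exact hle ha

/-! ## §6  KERNEL TRANSFER: the axis restriction of 30352 is free under the binders `B, L, Q, U⊥` -/

/-- **`entangled_of_axisRestricted : B → L → Q → U⊥ → (30352 on axis tuples) → 30352`.**  A tight atom `z` (the data of 30352) that fails is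
conjugation-stable under `B` (§3), hence its span has an AXIS ℚ-basis `w` (σ-normal form, tree), rescaled into
`span_ℤ z`; every hypothesis of 30352 is transported from `z` to `w'` (ecl ∅ and span-minimality are span-local;
saturation descends along `ℚ(w', e^{w'}) ≤ ℚ(z, e^z)` and the common span; the affine / quadratic / rational-image
non-degeneracies of `w'` come from the BINDERS `L, Q, U⊥` (with `B`), exactly as in the live `closes`; the
entanglement grade is a span invariant, §5); the piece applied to `w'` contradicts `trdeg ℚ(w', e^{w'}) =
trdeg ℚ(z, e^z) < n`. -/
theorem entangled_of_axisRestricted (hD : DefectOneSchanuel) (hL : LinearSchanuel) (hQ : QuadraticSchanuel)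
    (hU : RationalImageSchanuel)
    (hax : ∀ (n : ℕ), 3 ≤ n → ∀ (z : Fin n → ℂ), LinearIndependent ℚ z → (∀ i, z i ∈ Literature.NumberTheory.Transcendental.ecl (∅ : Set ℂ)) → (∀ (m : ℕ), m < n → ∀ (w : Fin m → ℂ), LinearIndependent ℚ w → (∀ i, w i ∈ Submodule.span ℚ (Set.range z)) → (m : Cardinal) ≤ Algebra.trdeg ℚ ↥(IntermediateField.adjoin ℚ (Set.range w ∪ Set.range (Complex.exp ∘ w)))) → (∀ w : ℂ, IsAlgebraic ↥(IntermediateField.adjoin ℚ (Set.range z ∪ Set.range (Complex.exp ∘ z))) w → IsAlgebraic ↥(IntermediateField.adjoin ℚ (Set.range z ∪ Set.range (Complex.exp ∘ z))) (Complex.exp w) → w ∈ Submodule.span ℚ (Set.range z)) → (∀ (k : ℕ) (t : Fin k → ℂ) (β₀ γ₀ : Fin n → ℂ) (β γ : Fin n → Fin k → ℂ), (∀ i, IsAlgebraic ℚ (β₀ i)) → (∀ i j, IsAlgebraic ℚ (β i j)) → (∀ i, IsAlgebraic ℚ (γ₀ i)) → (∀ i j, IsAlgebraic ℚ (γ i j))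 → (∀ i, z i = β₀ i + ∑ j, β i j * t j) → (∀ i, Complex.exp (z i) = γ₀ i + ∑ j, γ i j * t j) → n ≤ k) → (∀ (k : ℕ) (t : Fin k → ℂ) (β₀ γ₀ : Fin n → ℂ) (β γ : Fin n → Fin k → ℂ) (δ ε : Fin n → Fin k → Fin k → ℂ), (∀ i, IsAlgebraic ℚ (β₀ i)) → (∀ i j, IsAlgebraic ℚ (β i j)) → (∀ i j j', IsAlgebraic ℚ (δ i j j')) → (∀ i, IsAlgebraic ℚ (γ₀ i)) → (∀ i j, IsAlgebraic ℚ (γ i j)) → (∀ i j j', IsAlgebraic ℚ (ε i j j')) → (∀ i, z i = β₀ i + ∑ j, β i j * t j + ∑ j, ∑ j', δ i j j' * (t j * t j')) → (∀ i, Complex.exp (z i) = γ₀ i + ∑ j, γ i j * t j + ∑ j, ∑ j', ε i j j' * (t j * t j')) → n ≤ k) → (∀ (k : ℕ) (t : Fin k → ℂ) (D : MvPolynomial (Fin k) ℂ) (N E : Fin n → MvPolynomial (Fin k) ℂ), (∀ m, IsAlgebraic ℚ (MvPolynomial.coeff m D)) → (∀ i m, IsAlgebraic ℚ (MvPolynomial.coeff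 m (N i))) → (∀ i m, IsAlgebraic ℚ (MvPolynomial.coeff m (E i))) → MvPolynomial.eval t D ≠ 0 → (∀ i, z i * MvPolynomial.eval t D = MvPolynomial.eval t (N i)) → (∀ i, Complex.exp (z i) * MvPolynomial.eval t D = MvPolynomial.eval t (E i)) → n ≤ k) → (Algebra.trdeg ℚ ↥(IntermediateField.adjoin ℚ (Set.range z ∪ Set.range (Complex.exp ∘ z))) < Algebra.trdeg ℚ ↥(IntermediateField.adjoin ℚ (Set.range z)) + Algebra.trdeg ℚ ↥(IntermediateField.adjoin ℚ (Set.range (Complex.exp ∘ z)))) → (∀ i, (z i).im = 0 ∨ (z i).re = 0) → (n : Cardinal) ≤ Algebra.trdeg ℚ ↥(IntermediateField.adjoin ℚ (Set.range z ∪ Set.range (Complex.exp ∘ z)))) :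
    EntangledSaturatedEssentialSchanuel := by
  classical
  intro n hn z hz hecl hmin hsat hlin hquad hrat hent
  by_contra hlt
  have hlt' : Algebra.trdeg ℚ ↥(adjoin ℚ (Set.range z ∪ Set.range (Complex.exp ∘ z))) < (n : Cardinal) :=
    lt_of_not_ge hlt
  -- (1) rigidity: the span is conjugation-stable, hence has an axis basis
  have hσ := conj_mem_span_of_atom hD hz hlt' hmin
  obtain ⟨p, w, hwax, hwli, hwmem, hple⟩ := exists_axis_tuple_of_conj_stable (Fin n) z hσ
  haveI : FiniteDimensional ℚ ↥(Submodule.span ℚ (Set.range z)) :=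
    FiniteDimensional.span_of_finite ℚ (Set.finite_range z)
  have hVn : Module.finrank ℚ ↥(Submodule.span ℚ (Set.range z)) = n := by
    rw [finrank_span_eq_card hz, Fintype.card_fin]
  have hWle : Submodule.span ℚ (Set.range w) ≤ Submodule.span ℚ (Set.range z) :=
    Submodule.span_le.mpr (Set.range_subset_iff.mpr hwmem)
  have hpn : n = p := by
    apply le_antisymm
    · rw [hVn] at hple; exact hple
    · have h := Submodule.finrank_mono hWle
      rw [finrank_span_eq_card hwli, Fintype.card_fin, hVn] at h
      exact h
  cases hpn
  -- (2) rescale the axis basis into the ℤ-span of z (axis shape is preserved)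
  choose M hM hMmem using fun i => exists_nsmul_mem_span_int z (hwmem i)
  let w' : Fin n → ℂ := fun i => ((M i : ℕ) : ℂ) * w i
  have hw'_eq : ∀ i, w' i = (M i : ℚ) • w i := fun i => by
    show ((M i : ℕ) : ℂ) * w i = _
    rw [Rat.smul_def, Rat.cast_natCast]
  have hw'Z : ∀ i, w' i ∈ Submodule.span ℤ (Set.range z) := fun i => by rw [hw'_eq]; exact hMmem i
  have hw'ax : ∀ i, (w' i).im = 0 ∨ (w' i).re = 0 := by
    intro i
    rcases hwax i with h | h
    · left; simp [w', Complex.mul_im, h]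
    · right; simp [w', Complex.mul_re, h]
  have hw'li : LinearIndependent ℚ w' := by
    let c : Fin n → ℚˣ := fun i => Units.mk0 (M i : ℚ) (Nat.cast_ne_zero.mpr (hM i))
    have he : c • w = w' := by
      funext i
      rw [Pi.smul_apply', hw'_eq i]
      simp only [c, Units.smul_def, Units.val_mk0]
    exact he ▸ hwli.units_smul c
  have hw'V : ∀ i, w' i ∈ Submodule.span ℚ (Set.range z) := fun i => by
    rw [hw'_eq]; exact Submodule.smul_mem _ _ (hwmem i)
  have hspan : Submodule.span ℚ (Set.range w') = Submodule.span ℚ (Set.range z) := by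
    apply Submodule.eq_of_le_of_finrank_eq (Submodule.span_le.mpr (Set.range_subset_iff.mpr hw'V))
    rw [finrank_span_eq_card hw'li, finrank_span_eq_card hz]
  have hzW : ∀ l, z l ∈ Submodule.span ℚ (Set.range w') := fun l => by
    rw [hspan]; exact Submodule.subset_span ⟨l, rfl⟩
  -- (3) transport of the predicate stack of 30352 from z to w'
  have hFle : adjoin ℚ (Set.range w' ∪ Set.range (Complex.exp ∘ w')) ≤
      adjoin ℚ (Set.range z ∪ Set.range (Complex.exp ∘ z)) := adjoin_pair_le_of_mem_span_int hw'Z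
  have hE1 := trdeg_pair_eq_of_basis_change hw'Z hzW
  have hE2 := adjoin_range_eq_of_basis_change hw'Z hzW
  have hE3 := trdeg_exp_eq_of_basis_change hw'Z hzW
  have hecl' : ∀ i, w' i ∈ Literature.NumberTheory.Transcendental.ecl (∅ : Set ℂ) := fun i =>
    mem_ecl_of_mem_span hecl (hw'V i)
  have hmin' : ∀ (m : ℕ), m < n → ∀ (v : Fin m → ℂ), LinearIndependent ℚ v →
      (∀ i, v i ∈ Submodule.span ℚ (Set.range w')) →
      (m : Cardinal) ≤ Algebra.trdeg ℚ ↥(adjoin ℚ (Set.range v ∪ Set.range (Complex.exp ∘ v))) :=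
    fun m hm v hv hvmem => hmin m hm v hv (fun i => by rw [← hspan]; exact hvmem i)
  have hsat' : ∀ u : ℂ, IsAlgebraic ↥(adjoin ℚ (Set.range w' ∪ Set.range (Complex.exp ∘ w'))) u →
      IsAlgebraic ↥(adjoin ℚ (Set.range w' ∪ Set.range (Complex.exp ∘ w'))) (Complex.exp u) →
      u ∈ Submodule.span ℚ (Set.range w') := fun u h1 h2 => by
    rw [hspan]; exact hsat u (isAlgebraic_of_le hFle h1) (isAlgebraic_of_le hFle h2)
  -- the affine / quadratic / rational-image non-degeneracies of w' FROM THE BINDERS (as in the live `closes`)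
  have hlin' : ∀ (k : ℕ) (t : Fin k → ℂ) (β₀ γ₀ : Fin n → ℂ) (β γ : Fin n → Fin k → ℂ),
      (∀ i, IsAlgebraic ℚ (β₀ i)) → (∀ i j, IsAlgebraic ℚ (β i j)) →
      (∀ i, IsAlgebraic ℚ (γ₀ i)) → (∀ i j, IsAlgebraic ℚ (γ i j)) →
      (∀ i, w' i = β₀ i + ∑ j, β i j * t j) →
      (∀ i, Complex.exp (w' i) = γ₀ i + ∑ j, γ i j * t j) → n ≤ k :=
    fun k t β₀ γ₀ β γ hβ₀ hβ hγ₀ hγ hzr her => hL n k w' t β₀ γ₀ β γ hw'li hβ₀ hβ hγ₀ hγ hzr her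
  have hquad' : ∀ (k : ℕ) (t : Fin k → ℂ) (β₀ γ₀ : Fin n → ℂ) (β γ : Fin n → Fin k → ℂ)
      (δ ε : Fin n → Fin k → Fin k → ℂ),
      (∀ i, IsAlgebraic ℚ (β₀ i)) → (∀ i j, IsAlgebraic ℚ (β i j)) →
      (∀ i j j', IsAlgebraic ℚ (δ i j j')) →
      (∀ i, IsAlgebraic ℚ (γ₀ i)) → (∀ i j, IsAlgebraic ℚ (γ i j)) →
      (∀ i j j', IsAlgebraic ℚ (ε i j j')) →
      (∀ i, w' i = β₀ i + ∑ j, β i j * t j + ∑ j, ∑ j', δ i j j' * (t j * t j')) →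
      (∀ i, Complex.exp (w' i) = γ₀ i + ∑ j, γ i j * t j + ∑ j, ∑ j', ε i j j' * (t j * t j')) →
      n ≤ k :=
    fun k t β₀ γ₀ β γ δ ε hβ₀ hβ hδ hγ₀ hγ hε hzr her =>
      hQ n k w' t β₀ γ₀ β γ δ ε hw'li hlin' hβ₀ hβ hδ hγ₀ hγ hε hzr her
  have hrat' : ∀ (k : ℕ) (t : Fin k → ℂ) (D : MvPolynomial (Fin k) ℂ) (N E : Fin n → MvPolynomial (Fin k) ℂ),
      (∀ m, IsAlgebraic ℚ (MvPolynomial.coeff m D)) → (∀ i m, IsAlgebraic ℚ (MvPolynomial.coeff m (N i))) →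
      (∀ i m, IsAlgebraic ℚ (MvPolynomial.coeff m (E i))) → MvPolynomial.eval t D ≠ 0 →
      (∀ i, w' i * MvPolynomial.eval t D = MvPolynomial.eval t (N i)) →
      (∀ i, Complex.exp (w' i) * MvPolynomial.eval t D = MvPolynomial.eval t (E i)) → n ≤ k :=
    fun k t D N E hDc hN hE hD0 hzr her =>
      hU n k w' t D N E hw'li hlin' hquad' (hD n w' hw'li) hDc hN hE hD0 hzr her
  -- the entanglement grade is a span invariant
  have hent' : Algebra.trdeg ℚ ↥(adjoin ℚ (Set.range w' ∪ Set.range (Complex.exp ∘ w'))) <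
      Algebra.trdeg ℚ ↥(adjoin ℚ (Set.range w')) +
        Algebra.trdeg ℚ ↥(adjoin ℚ (Set.range (Complex.exp ∘ w'))) := by
    rw [hE1, hE2, hE3]; exact hent
  -- (4) the piece at the axis basis
  have happ := hax n hn w' hw'li hecl' hmin' hsat' hlin' hquad' hrat' hent' hw'ax
  rw [hE1] at happ
  exact hlt happ

end Summit.Schanuel.Schanuel.Theorems.RootDecomp1AtomRigidity
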